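import Literature.Geometry.Kaehler.ComplexTorusCyclotomicAutomorphismMumfordTateThreefolds
import Literature.Geometry.Kaehler.ComplexTorusCyclotomicAutomorphismOrderEleven
import Literature.Geometry.Kaehler.ComplexTorusCyclotomicAutomorphismOrderEightTwelve
import Literature.AlgebraicGeometry.ComplexMultiplication.CMTorusMumfordTateRankIsogeny
import Literature.AlgebraicGeometry.ComplexMultiplication.CyclotomicCMTypeCensusSevenNine
import Literature.AlgebraicGeometry.ComplexMultiplication.CyclotomicCMTypeCensusEleven
import Literature.AlgebraicGeometry.ComplexMultiplication.CyclotomicFermatCMTypesKoblitzEllipticFields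
import Literature.AlgebraicGeometry.Pohlmann1968.CMTypeRankInducedType
import Literature.AlgebraicGeometry.Pohlmann1968.NondegenerateCMTypeDivisorGenerated
import Literature.AlgebraicGeometry.Pohlmann1968.NondegenerateCMTypeHodgeConjecture
import Literature.NumberTheory.ComplexMultiplication.CMTypeInducedFromPrimitive
import HarnessLib

/-!
# `rank MT(X) = 2` for the NON-simple complex tori with an automorphism of order `7`, `9`, `11`, `8` (and `P_u = Φ₁₂`):
# the types of `ℚ(ζ_N)` induced from an imaginary quadratic subfield have rank `2`

Layer `Literature/Geometry/Kaehler`, namespace `Literature.Geometry.Kaehler.ComplexTorus`; closes the «NOT here» of this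
seat's `ComplexTorusCyclotomicAutomorphismMumfordTateThreefolds` (generation 32: «`rank MT(X) = 2` for the non-simple threefolds
(`MT(X) = MT(E)`): … not threaded here») with the method of `ComplexTorusCyclotomicAutomorphismOrderSixteenHodge` (generation 33
FILE 4: `rank MT(X) = Rank(Φ)` for the model `ℂ^g/Φ(𝔞) ≅ X`, `Rank(Φ) = Rank(Φ₁)` for the primitive sub-pair `(K₁, Φ₁)`, and a
CM type of an imaginary quadratic field has rank `2`).  Lane `lit-hodgefound` (Track 2 foundations library), prover seat
`lit-hodgefound-p10`, generation 33, row «A2-26(gr)» (self-proposed 2026-08-28).  THEOREMS ONLY (no definition, no named fact,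
no `sorry`; kernel `decide` on `ℤ/7`, `ℤ/9`, `ℤ/11`, `ℤ/8`, `ℤ/12`).

THE SOURCES.  B. Dodson, J. Algebra **107** (1987), §1.1 p. 50 (`Rank(Φ) = dim MT(A)`, rank of the span of the Galois
translates); G. Shimura, *Abelian Varieties with Complex Multiplication and Modular Functions* (1998), §8.2 Prop. 26 (primitive
sub-pair on the fixed field of the stabiliser), §8.4 Examples (1)–(2) (types of `ℚ(ζ_N)` as residue sets; an abelian `F` of degree
`> 2` always has imprimitive types), §6.1 Thm. 2, §6.2 Thm. 3; N. Koblitz, D. Rohrlich, Canad. J. Math. **30** (1978), §1 p. 1184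
(`[L : K₁] = |W|`); B. Moonen, Yu. Zarhin, Math. Ann. **315** (1999), §1 (1.2) («for `n ≥ 1` we can identify `Hg(Xⁿ)` with `Hg(X)`»);
T. Kubota, Trans. AMS **118** (1965), §2 p. 115 (the rank is at most `n + 1`; a CM elliptic curve has rank `2`); Ch. Birkenhake,
H. Lange, *Complex Abelian Varieties* (2004), §13.3.

## What is proved

* §1 (`L = ℚ(ζ_N)`, any `N > 2`): **`cmTypeRank_eq_two_of_two_mul_card_filter_eq`** — a CM type of `ℚ(ζ_N)` whose residue stabiliser
  `W` has `2|W| = φ(N)` (i.e. the type is induced from an imaginary QUADRATIC subfield) has `Rank(Φ) = 2`;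
  **`mtRank_hodgeStructure_periodIso_eq_two_of_two_mul_card_filter_eq`** (`rank MT(ℂ^g/Φ(𝔞)) = 2` for such types).
* §2 (levels): kernel stabiliser counts (`2|W| = φ(N)` for the imprimitive residue sets of `ℤ/7`, `ℤ/9`, `ℤ/11` and for ALL residue sets
  of `ℤ/8`, `ℤ/12`), whence **`cmTypeRank_eq_two_of_not_isPrimitive_{seven,nine,eleven}`**, `cmTypeRank_eq_two_{eight,twelve}`, and the
  rank tables `cmTypeRank_eq_four_iff_isPrimitive_{seven,nine}`, `cmTypeRank_eq_six_iff_isPrimitive_eleven` (Yanai in prime dimension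
  for the primitive ones).
* §3 (tori `(X, u)`): **`mtRank_hodgeStructure_eq_two_of_not_isSimple_of_orderOf_eq_{seven,nine,eleven}`** (`dim X = 3, 3, 5`),
  `mtRank_hodgeStructure_eq_four_iff_isSimple_of_orderOf_eq_{seven,nine}`, `mtRank_hodgeStructure_eq_six_iff_isSimple_of_orderOf_eq_eleven`,
  **`mtRank_hodgeStructure_eq_two_of_orderOf_eq_eight`** (every `2`-torus with an automorphism of order `8`),
  `mtRank_hodgeStructure_eq_two_of_charpoly_eq_cyclotomic_twelve` (every torus with `P_u = Φ₁₂`).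

NOT HERE: `orderOf u = 12` on a `2`-torus without the hypothesis `P_u = Φ₁₂` (then `P_u` may be `Φ₃Φ₄`, `Φ₄Φ₆`, …: products
`E × E′`); the finite-order endomorphisms of the non-simple tori.

## References

* [Dodson1987] B. Dodson, *On the Mumford–Tate group of an abelian variety with complex multiplication*, J. Algebra 107 (1987), §1.1 p. 50.
* [Shimura1998] G. Shimura, *Abelian Varieties with Complex Multiplication and Modular Functions* (1998), §6.1 Thm. 2, §6.2 Thm. 3,
  §8.2 Prop. 26, §8.4 Examples (1)–(2).
* [KoblitzRohrlich1978] N. Koblitz, D. Rohrlich, Canad. J. Math. 30 (1978), §1 p. 1184.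
* [MoonenZarhin1999LowDim] B. Moonen, Yu. Zarhin, Math. Ann. 315 (1999), §1 (1.2), Thm. 0.1.
* [Kubota1965] T. Kubota, Trans. AMS 118 (1965), §2 p. 115.
* [Yanai1985] H. Yanai, Nagoya Math. J. 97 (1985), §4 Theorem p. 171.
* [BirkenhakeLange2004] Ch. Birkenhake, H. Lange, *Complex Abelian Varieties*, 2nd ed. (2004), §13.3.
* [Fujiki1988] A. Fujiki, Publ. RIMS 24 (1988), Thm. 4.1 and Table 6.
-/

noncomputable section

open scoped Classical nonZeroDivisors NumberField Manifold ContDiff MatrixGroups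
open NumberField Module Polynomial

namespace Literature.Geometry.Kaehler

namespace ComplexTorus

-- `open scoped`: the tree's action of `Aut(ℂ)` on `Hom(K, ℂ)` by composition (`ringEquivCompAction`) is a scoped instance
open scoped Literature.NumberTheory.ComplexMultiplication
open Literature.AlgebraicGeometry.Motives (CMType HodgeTensorFacts)
open Literature.NumberTheory.ComplexMultiplication (IsPrimitive inducedCMType exists_primitive_inducedCMType_eq_of_isCMField)
open Literature.NumberTheory.ComplexMultiplication.CMTypeLattice (periodIso isSimple_periodIso_iff_isPrimitive)
open Literature.AlgebraicGeometry.Pohlmann1968 (cmTypeRank IsNondegenerate isNondegenerate_iff cmTypeRank_inducedCMType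
  isNondegenerate_of_finrank_eq_two isNondegenerate_of_isPrimitive_of_prime)
open Literature.AlgebraicGeometry.Pohlmann1968.Cyclotomic (finrank_eq_totient)
open Literature.AlgebraicGeometry.ComplexMultiplication (finrank_eq_two_of_two_mul_card_eq)
open Literature.AlgebraicGeometry.ComplexMultiplication.CMTorus (mtRank_hodgeStructure_periodIso_eq_cmTypeRank)
open Literature.AlgebraicGeometry.ComplexMultiplication.CyclotomicCMTypeResidueSets (unitResidues residueSet pullback allCMResidueSets
  IsCMResidueSet isCMResidueSet_residueSet residueSet_subset_unitResidues forall_mem_iff_iff_eq_pullback)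
open Literature.AlgebraicGeometry.ComplexMultiplication.CyclotomicCMTypeCensusSevenNine (not_isPrimitive_iff_stable_two_seven
  not_isPrimitive_iff_stable_four_nine)
open Literature.AlgebraicGeometry.ComplexMultiplication.CyclotomicCMTypeCensusEleven (not_isPrimitive_iff_stable_three_eleven)

/-! ### §1 Types of `ℚ(ζ_N)` induced from an imaginary quadratic subfield have rank `2` -/

section General

variable {N : ℕ} [NeZero N] {L : Type} [Field L] [NumberField L] [IsCyclotomicExtension {N} ℚ L]

/-- `allCMResidueSets N` enumerates exactly the CM residue sets (membership unfolded). [cite: Shimura1998, §8.4 Example (1)] -/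
private theorem mem_allCMResidueSets_iff₃₆ (S : Finset (ZMod N)) : S ∈ allCMResidueSets N ↔ IsCMResidueSet N S := by
  rw [allCMResidueSets, Finset.mem_filter, Finset.mem_powerset]
  exact ⟨fun h => h.2, fun h => ⟨h.1, h⟩⟩

/-- The residue set of a CM type of `ℚ(ζ_N)` is one of the CM residue sets. [cite: Shimura1998, §8.4 Example (1)] -/
private theorem residueSet_mem₃₆ (Φ : CMType L) : residueSet N Φ ∈ allCMResidueSets N :=
  (mem_allCMResidueSets_iff₃₆ _).2 (isCMResidueSet_residueSet N Φ)

/-- «`S_Φ` stable under `t`» in the membership spelling is `S_Φ·t⁻¹ = S_Φ`. [cite: Shimura1998, §8.4 Example (1)] -/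
private theorem stable_iff_pullback_eq₃₆ (Φ : CMType L) (t : ZMod N) :
    (∀ c ∈ unitResidues N, (c * t ∈ residueSet N Φ ↔ c ∈ residueSet N Φ)) ↔ pullback N t (residueSet N Φ) = residueSet N Φ := by
  rw [eq_comm, ← forall_mem_iff_iff_eq_pullback (residueSet_subset_unitResidues N Φ) t]
  exact forall₂_congr fun c _ => Iff.comm

/-- **`Rank(Φ) = 2` FOR A TYPE OF `ℚ(ζ_N)` INDUCED FROM AN IMAGINARY QUADRATIC SUBFIELD** (`2|W| = φ(N)`, `W` the residue
stabiliser): the primitive sub-pair `(K₁, Φ₁)` has `[K₁ : ℚ] = φ(N)/|W| = 2`, `Rank(Φ) = Rank(Φ₁)` (Shimura's `r(ξ) = r(Inf ξ)`),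
and a CM type of an imaginary quadratic field has rank `2 = 1 + 1` (Kubota). [cite: Dodson1987, §1.1 (p. 50)]
[cite: KoblitzRohrlich1978, §1 p. 1184] [cite: Shimura1998, §8.2 Prop. 26] [cite: Kubota1965, §2 (p. 115)] -/
theorem cmTypeRank_eq_two_of_two_mul_card_filter_eq (hN : 2 < N) (Φ : CMType L)
    (hW : 2 * ((unitResidues N).filter fun t =>
        ∀ c ∈ unitResidues N, (c * t ∈ residueSet N Φ ↔ c ∈ residueSet N Φ)).card = N.totient) :
    cmTypeRank Φ = 2 := by
  haveI : IsCMField L := IsCyclotomicExtension.Rat.isCMField L (S := ({N} : Set ℕ)) ⟨N, rfl, hN⟩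
  obtain ⟨K₁, Φ₁, hCM, h₁, hp₁, -⟩ := exists_primitive_inducedCMType_eq_of_isCMField Φ
  haveI := hCM
  have h2 := finrank_eq_two_of_two_mul_card_eq (N := N) Φ Φ₁ h₁ hp₁ hW
  rw [← h₁, cmTypeRank_inducedCMType, (isNondegenerate_iff Φ₁).1 (isNondegenerate_of_finrank_eq_two Φ₁ h2), h2]

/-- **`rank MT(ℂ^g/Φ(𝔞)) = 2`** for such a type and every ideal `𝔞` (`rank MT = Rank(Φ)`). [cite: Dodson1987, §1.1 (p. 50)]
[cite: MoonenZarhin1999LowDim, §1 (1.2)] -/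
theorem mtRank_hodgeStructure_periodIso_eq_two_of_two_mul_card_filter_eq [HodgeTensorFacts.{0, 0}] (hN : 2 < N) (Φ : CMType L)
    (I : (FractionalIdeal (𝓞 L)⁰ L)ˣ)
    (hW : 2 * ((unitResidues N).filter fun t =>
        ∀ c ∈ unitResidues N, (c * t ∈ residueSet N Φ ↔ c ∈ residueSet N Φ)).card = N.totient) :
    (hodgeStructure (periodIso Φ I) 1).mtRank = 2 := by
  haveI : IsCMField L := IsCyclotomicExtension.Rat.isCMField L (S := ({N} : Set ℕ)) ⟨N, rfl, hN⟩
  rw [mtRank_hodgeStructure_periodIso_eq_cmTypeRank Φ I, cmTypeRank_eq_two_of_two_mul_card_filter_eq hN Φ hW]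

omit [NeZero N] in
/-- `rank MT(ℂ^g/Φ(𝔞)) = Rank(Φ)` for the models of `ℚ(ζ_N)`, `N > 2` (the CM instance supplied). [cite: Dodson1987, §1.1 (p. 50)] -/
theorem mtRank_hodgeStructure_periodIso_eq_cmTypeRank_of_two_lt [HodgeTensorFacts.{0, 0}] (hN : 2 < N) (Φ : CMType L)
    (I : (FractionalIdeal (𝓞 L)⁰ L)ˣ) : (hodgeStructure (periodIso Φ I) 1).mtRank = cmTypeRank Φ := by
  haveI : IsCMField L := IsCyclotomicExtension.Rat.isCMField L (S := ({N} : Set ℕ)) ⟨N, rfl, hN⟩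
  exact mtRank_hodgeStructure_periodIso_eq_cmTypeRank Φ I

end General

/-! ### §2 The levels `7`, `9`, `11` (imprimitive types) and `8`, `12` (all types): `2|W| = φ(N)` -/

section Levels

set_option maxRecDepth 100000 in
/-- Kernel: an imprimitive CM residue set of `ℤ/7` (stable under `2`), `ℤ/9` (under `4`), `ℤ/11` (under `3`) has `2|W| = φ(N)`;
EVERY CM residue set of `ℤ/8` and of `ℤ/12` has `2|W| = 4`. [cite: Shimura1998, §8.4 Examples (1)–(2)] [cite: KoblitzRohrlich1978, §1 p. 1184] -/
private theorem card_filter_two_mul_card_ne :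
    ((allCMResidueSets 7).filter fun S => pullback 7 2 S = S ∧
        2 * ((unitResidues 7).filter fun t => ∀ c ∈ unitResidues 7, (c * t ∈ S ↔ c ∈ S)).card ≠ 6).card = 0 ∧
    ((allCMResidueSets 9).filter fun S => pullback 9 4 S = S ∧
        2 * ((unitResidues 9).filter fun t => ∀ c ∈ unitResidues 9, (c * t ∈ S ↔ c ∈ S)).card ≠ 6).card = 0 ∧
    ((allCMResidueSets 11).filter fun S => pullback 11 3 S = S ∧
        2 * ((unitResidues 11).filter fun t => ∀ c ∈ unitResidues 11, (c * t ∈ S ↔ c ∈ S)).card ≠ 10).card = 0 ∧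
    ((allCMResidueSets 8).filter fun S =>
        2 * ((unitResidues 8).filter fun t => ∀ c ∈ unitResidues 8, (c * t ∈ S ↔ c ∈ S)).card ≠ 4).card = 0 ∧
    ((allCMResidueSets 12).filter fun S =>
        2 * ((unitResidues 12).filter fun t => ∀ c ∈ unitResidues 12, (c * t ∈ S ↔ c ∈ S)).card ≠ 4).card = 0 := by
  refine ⟨?_, ?_, ?_, ?_, ?_⟩ <;> decide +kernel

/-- `φ(7) = 6`, `φ(9) = 6`, `φ(11) = 10`, `φ(8) = 4`, `φ(12) = 4`. [folklore] -/
private theorem totients₃₆ : Nat.totient 7 = 6 ∧ Nat.totient 9 = 6 ∧ Nat.totient 11 = 10 ∧ Nat.totient 8 = 4 ∧ Nat.totient 12 = 4 := by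
  decide

/-- **The imprimitive types of `ℚ(ζ₇)` have rank `2`** (induced from `ℚ(√−7)`). [cite: Shimura1998, §8.4 Example (2)] [cite: Kubota1965, §2 (p. 115)] -/
theorem cmTypeRank_eq_two_of_not_isPrimitive_seven {L : Type} [Field L] [NumberField L] [IsCyclotomicExtension {7} ℚ L]
    (Φ : CMType L) (φ₀ : L →+* ℂ) (hΦ : ¬ IsPrimitive (ℂ ≃+* ℂ) Φ.1 φ₀) : cmTypeRank Φ = 2 := by
  have h2 := (stable_iff_pullback_eq₃₆ (N := 7) Φ 2).1 ((not_isPrimitive_iff_stable_two_seven Φ φ₀).1 hΦ)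
  have h0 := Finset.filter_eq_empty_iff.1 (Finset.card_eq_zero.1 card_filter_two_mul_card_ne.1) (residueSet_mem₃₆ (N := 7) Φ)
  rw [not_and, not_not] at h0
  exact cmTypeRank_eq_two_of_two_mul_card_filter_eq (N := 7) (by norm_num) Φ (by rw [h0 h2, totients₃₆.1])

/-- **The imprimitive types of `ℚ(ζ₉)` have rank `2`** (induced from `ℚ(√−3)`). [cite: Shimura1998, §8.4 Example (2)] [cite: Kubota1965, §2 (p. 115)] -/
theorem cmTypeRank_eq_two_of_not_isPrimitive_nine {L : Type} [Field L] [NumberField L] [IsCyclotomicExtension {9} ℚ L]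
    (Φ : CMType L) (φ₀ : L →+* ℂ) (hΦ : ¬ IsPrimitive (ℂ ≃+* ℂ) Φ.1 φ₀) : cmTypeRank Φ = 2 := by
  have h4 := (stable_iff_pullback_eq₃₆ (N := 9) Φ 4).1 ((not_isPrimitive_iff_stable_four_nine Φ φ₀).1 hΦ)
  have h0 := Finset.filter_eq_empty_iff.1 (Finset.card_eq_zero.1 card_filter_two_mul_card_ne.2.1) (residueSet_mem₃₆ (N := 9) Φ)
  rw [not_and, not_not] at h0
  exact cmTypeRank_eq_two_of_two_mul_card_filter_eq (N := 9) (by norm_num) Φ (by rw [h0 h4, totients₃₆.2.1])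

/-- **The imprimitive types of `ℚ(ζ₁₁)` have rank `2`** (induced from `ℚ(√−11)`). [cite: Shimura1998, §8.4 Example (2)] [cite: Kubota1965, §2 (p. 115)] -/
theorem cmTypeRank_eq_two_of_not_isPrimitive_eleven {L : Type} [Field L] [NumberField L] [IsCyclotomicExtension {11} ℚ L]
    (Φ : CMType L) (φ₀ : L →+* ℂ) (hΦ : ¬ IsPrimitive (ℂ ≃+* ℂ) Φ.1 φ₀) : cmTypeRank Φ = 2 := by
  have h3 := (stable_iff_pullback_eq₃₆ (N := 11) Φ 3).1 ((not_isPrimitive_iff_stable_three_eleven Φ φ₀).1 hΦ)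
  have h0 := Finset.filter_eq_empty_iff.1 (Finset.card_eq_zero.1 card_filter_two_mul_card_ne.2.2.1) (residueSet_mem₃₆ (N := 11) Φ)
  rw [not_and, not_not] at h0
  exact cmTypeRank_eq_two_of_two_mul_card_filter_eq (N := 11) (by norm_num) Φ (by rw [h0 h3, totients₃₆.2.2.1])

/-- **Every CM type of `ℚ(ζ₈)` has rank `2`** (all four are induced from `ℚ(i)` or `ℚ(√−2)`). [cite: Shimura1998, §8.4 Example (2)(A), p. 64]
[cite: Kubota1965, §2 (p. 115)] -/
theorem cmTypeRank_eq_two_eight {L : Type} [Field L] [NumberField L] [IsCyclotomicExtension {8} ℚ L] (Φ : CMType L) :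
    cmTypeRank Φ = 2 := by
  have h0 := Finset.filter_eq_empty_iff.1 (Finset.card_eq_zero.1 card_filter_two_mul_card_ne.2.2.2.1) (residueSet_mem₃₆ (N := 8) Φ)
  rw [not_not] at h0
  exact cmTypeRank_eq_two_of_two_mul_card_filter_eq (N := 8) (by norm_num) Φ (by rw [h0, totients₃₆.2.2.2.1])

/-- **Every CM type of `ℚ(ζ₁₂)` has rank `2`** (all four are induced from `ℚ(i)` or `ℚ(√−3)`). [cite: Shimura1998, §8.4 Example (2)(A), p. 64]
[cite: Kubota1965, §2 (p. 115)] -/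
theorem cmTypeRank_eq_two_twelve {L : Type} [Field L] [NumberField L] [IsCyclotomicExtension {12} ℚ L] (Φ : CMType L) :
    cmTypeRank Φ = 2 := by
  have h0 := Finset.filter_eq_empty_iff.1 (Finset.card_eq_zero.1 card_filter_two_mul_card_ne.2.2.2.2) (residueSet_mem₃₆ (N := 12) Φ)
  rw [not_not] at h0
  exact cmTypeRank_eq_two_of_two_mul_card_filter_eq (N := 12) (by norm_num) Φ (by rw [h0, totients₃₆.2.2.2.2])

/-- **THE RANK TABLE OF `ℚ(ζ₇)`: `Rank(Φ) = 4 ⟺ Φ` primitive** (else `2`; Yanai in prime degree `2·3`). [cite: Yanai1985, §4 Theorem (p. 171)]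
[cite: Kubota1965, §2 (p. 115)] -/
theorem cmTypeRank_eq_four_iff_isPrimitive_seven {L : Type} [Field L] [NumberField L] [IsCyclotomicExtension {7} ℚ L]
    (Φ : CMType L) (φ₀ : L →+* ℂ) : cmTypeRank Φ = 4 ↔ IsPrimitive (ℂ ≃+* ℂ) Φ.1 φ₀ := by
  haveI : IsCMField L := IsCyclotomicExtension.Rat.isCMField L (S := ({7} : Set ℕ)) ⟨7, rfl, by norm_num⟩
  refine ⟨fun h ↦ ?_, fun hΦ ↦ ?_⟩
  · by_contra hnp
    rw [cmTypeRank_eq_two_of_not_isPrimitive_seven Φ φ₀ hnp] at h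
    omega
  · have hnd := isNondegenerate_of_isPrimitive_of_prime (Φ := Φ) Nat.prime_three
      (by rw [finrank_eq_totient 7 L, totients₃₆.1]) φ₀ hΦ
    rw [(isNondegenerate_iff Φ).1 hnd, finrank_eq_totient 7 L, totients₃₆.1]

/-- **THE RANK TABLE OF `ℚ(ζ₉)`: `Rank(Φ) = 4 ⟺ Φ` primitive** (else `2`). [cite: Yanai1985, §4 Theorem (p. 171)] [cite: Kubota1965, §2 (p. 115)] -/
theorem cmTypeRank_eq_four_iff_isPrimitive_nine {L : Type} [Field L] [NumberField L] [IsCyclotomicExtension {9} ℚ L]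
    (Φ : CMType L) (φ₀ : L →+* ℂ) : cmTypeRank Φ = 4 ↔ IsPrimitive (ℂ ≃+* ℂ) Φ.1 φ₀ := by
  haveI : IsCMField L := IsCyclotomicExtension.Rat.isCMField L (S := ({9} : Set ℕ)) ⟨9, rfl, by norm_num⟩
  refine ⟨fun h ↦ ?_, fun hΦ ↦ ?_⟩
  · by_contra hnp
    rw [cmTypeRank_eq_two_of_not_isPrimitive_nine Φ φ₀ hnp] at h
    omega
  · have hnd := isNondegenerate_of_isPrimitive_of_prime (Φ := Φ) Nat.prime_three
      (by rw [finrank_eq_totient 9 L, totients₃₆.2.1]) φ₀ hΦ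
    rw [(isNondegenerate_iff Φ).1 hnd, finrank_eq_totient 9 L, totients₃₆.2.1]

/-- **THE RANK TABLE OF `ℚ(ζ₁₁)`: `Rank(Φ) = 6 ⟺ Φ` primitive** (else `2`). [cite: Yanai1985, §4 Theorem (p. 171)] [cite: Kubota1965, §2 (p. 115)] -/
theorem cmTypeRank_eq_six_iff_isPrimitive_eleven {L : Type} [Field L] [NumberField L] [IsCyclotomicExtension {11} ℚ L]
    (Φ : CMType L) (φ₀ : L →+* ℂ) : cmTypeRank Φ = 6 ↔ IsPrimitive (ℂ ≃+* ℂ) Φ.1 φ₀ := by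
  haveI : IsCMField L := IsCyclotomicExtension.Rat.isCMField L (S := ({11} : Set ℕ)) ⟨11, rfl, by norm_num⟩
  refine ⟨fun h ↦ ?_, fun hΦ ↦ ?_⟩
  · by_contra hnp
    rw [cmTypeRank_eq_two_of_not_isPrimitive_eleven Φ φ₀ hnp] at h
    omega
  · have hnd := isNondegenerate_of_isPrimitive_of_prime (Φ := Φ) Nat.prime_five
      (by rw [finrank_eq_totient 11 L, totients₃₆.2.2.1]) φ₀ hΦ
    rw [(isNondegenerate_iff Φ).1 hnd, finrank_eq_totient 11 L, totients₃₆.2.2.1]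

end Levels

/-! ### §3 The tori: `rank MT(X) = 2` for the non-simple `(X, u)` -/

section Tori

variable {ι : Type} [Fintype ι] [DecidableEq ι] {E : Type} [NormedAddCommGroup E] [NormedSpace ℂ E]
  {P : (ι → ℝ) ≃L[ℝ] E}

/-- `8 = 2³` is a prime power. [folklore] -/
private theorem isPrimePow_eight₃₆ : IsPrimePow 8 :=
  (isPrimePow_nat_iff 8).2 ⟨2, 3, Nat.prime_two, by norm_num, by norm_num⟩

set_option backward.isDefEq.respectTransparency false in -- Mathlib's instance
-- `IsCyclotomicExtension {7} ℚ (CyclotomicField 7 ℚ)` is keyed on `CyclotomicField.algebra`, the goal on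
-- `DivisionRing.toRatAlgebra` (same workaround as `ComplexTorusCyclotomicAutomorphismMumfordTateThreefolds`)
/-- **`rank MT(X) = 2` FOR A NON-SIMPLE `3`-TORUS WITH AN ENDOMORPHISM OF ORDER `7`** (`X ≅ ℂ³/Φ(𝔞)`, `Φ` imprimitive, induced from
`ℚ(√−7)`: `X ∼ E³` and `MT(X) = MT(E)` has rank `2`). [cite: MoonenZarhin1999LowDim, §1 (1.2)] [cite: Dodson1987, §1.1 (p. 50)]
[cite: Shimura1998, §6.1 Thm. 2, §8.4 Example (2)] [cite: BirkenhakeLange2004, §13.3] -/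
theorem mtRank_hodgeStructure_eq_two_of_not_isSimple_of_orderOf_eq_seven [HodgeTensorFacts.{0, 0}] (hns : ¬ ComplexTorus.IsSimple P)
    {A : Matrix ι ι ℤ} (hA : A ∈ endRingInt P) (hord : orderOf A = 7) (hdim : finrank ℂ E = 3) : (hodgeStructure P 1).mtRank = 2 := by
  have hζ := IsCyclotomicExtension.zeta_spec 7 ℚ (CyclotomicField 7 ℚ)
  obtain ⟨Φ, I, e, he, he₂, -⟩ :=
    exists_cmType_ideal_iso_of_charpoly_eq_cyclotomic hζ hA (charpoly_eq_cyclotomic_seven_of_orderOf hord hdim P)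
  have hX : IsIsomorphic P (periodIso Φ I) := ⟨e, he, he₂⟩
  obtain ⟨φ₀⟩ : Nonempty (CyclotomicField 7 ℚ →+* ℂ) := inferInstance
  have hnp : ¬ IsPrimitive (ℂ ≃+* ℂ) Φ.1 φ₀ := fun h ↦ hns (hX.isSimple_iff.2 ((isSimple_periodIso_iff_isPrimitive Φ I φ₀).2 h))
  rw [IsIsomorphic.mtRank_hodgeStructure_eq P (periodIso Φ I) (k := 1) hX,
    mtRank_hodgeStructure_periodIso_eq_cmTypeRank_of_two_lt (N := 7) (by norm_num) Φ I, cmTypeRank_eq_two_of_not_isPrimitive_seven Φ φ₀ hnp]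

/-- **`rank MT(X) = 4 ⟺ X` SIMPLE** for a `3`-torus with an endomorphism of order `7` (`4` or `2`). [cite: Yanai1985, §4 Theorem (p. 171)]
[cite: MoonenZarhin1999LowDim, §1 (1.2)] -/
theorem mtRank_hodgeStructure_eq_four_iff_isSimple_of_orderOf_eq_seven [HodgeTensorFacts.{0, 0}] {A : Matrix ι ι ℤ}
    (hA : A ∈ endRingInt P) (hord : orderOf A = 7) (hdim : finrank ℂ E = 3) :
    (hodgeStructure P 1).mtRank = 4 ↔ ComplexTorus.IsSimple P := by
  refine ⟨fun h ↦ ?_, fun hX ↦ mtRank_hodgeStructure_eq_four_of_orderOf_eq_seven hX hA hord hdim⟩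
  by_contra hns
  rw [mtRank_hodgeStructure_eq_two_of_not_isSimple_of_orderOf_eq_seven hns hA hord hdim] at h
  omega

set_option backward.isDefEq.respectTransparency false in -- see above
/-- **`rank MT(X) = 2` FOR A NON-SIMPLE `3`-TORUS WITH AN ENDOMORPHISM OF ORDER `9`** (type induced from `ℚ(√−3)`: `X ∼ E³`).
[cite: MoonenZarhin1999LowDim, §1 (1.2)] [cite: Dodson1987, §1.1 (p. 50)] [cite: Shimura1998, §6.1 Thm. 2, §8.4 Example (2)] [cite: BirkenhakeLange2004, §13.3] -/
theorem mtRank_hodgeStructure_eq_two_of_not_isSimple_of_orderOf_eq_nine [HodgeTensorFacts.{0, 0}] (hns : ¬ ComplexTorus.IsSimple P)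
    {A : Matrix ι ι ℤ} (hA : A ∈ endRingInt P) (hord : orderOf A = 9) (hdim : finrank ℂ E = 3) : (hodgeStructure P 1).mtRank = 2 := by
  have hζ := IsCyclotomicExtension.zeta_spec 9 ℚ (CyclotomicField 9 ℚ)
  obtain ⟨Φ, I, e, he, he₂, -⟩ :=
    exists_cmType_ideal_iso_of_charpoly_eq_cyclotomic hζ hA (charpoly_eq_cyclotomic_nine_of_orderOf hord hdim P)
  have hX : IsIsomorphic P (periodIso Φ I) := ⟨e, he, he₂⟩
  obtain ⟨φ₀⟩ : Nonempty (CyclotomicField 9 ℚ →+* ℂ) := inferInstance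
  have hnp : ¬ IsPrimitive (ℂ ≃+* ℂ) Φ.1 φ₀ := fun h ↦ hns (hX.isSimple_iff.2 ((isSimple_periodIso_iff_isPrimitive Φ I φ₀).2 h))
  rw [IsIsomorphic.mtRank_hodgeStructure_eq P (periodIso Φ I) (k := 1) hX,
    mtRank_hodgeStructure_periodIso_eq_cmTypeRank_of_two_lt (N := 9) (by norm_num) Φ I, cmTypeRank_eq_two_of_not_isPrimitive_nine Φ φ₀ hnp]

/-- **`rank MT(X) = 4 ⟺ X` SIMPLE** for a `3`-torus with an endomorphism of order `9`. [cite: Yanai1985, §4 Theorem (p. 171)]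
[cite: MoonenZarhin1999LowDim, §1 (1.2)] -/
theorem mtRank_hodgeStructure_eq_four_iff_isSimple_of_orderOf_eq_nine [HodgeTensorFacts.{0, 0}] {A : Matrix ι ι ℤ}
    (hA : A ∈ endRingInt P) (hord : orderOf A = 9) (hdim : finrank ℂ E = 3) :
    (hodgeStructure P 1).mtRank = 4 ↔ ComplexTorus.IsSimple P := by
  refine ⟨fun h ↦ ?_, fun hX ↦ mtRank_hodgeStructure_eq_four_of_orderOf_eq_nine hX hA hord hdim⟩
  by_contra hns
  rw [mtRank_hodgeStructure_eq_two_of_not_isSimple_of_orderOf_eq_nine hns hA hord hdim] at h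
  omega

set_option backward.isDefEq.respectTransparency false in -- see above
/-- **`rank MT(X) = 2` FOR A NON-SIMPLE `5`-TORUS WITH AN ENDOMORPHISM OF ORDER `11`** (type induced from `ℚ(√−11)`: `X ∼ E⁵`).
[cite: MoonenZarhin1999LowDim, §1 (1.2)] [cite: Dodson1987, §1.1 (p. 50)] [cite: Shimura1998, §6.1 Thm. 2, §8.4 Example (2)] [cite: BirkenhakeLange2004, §13.3] -/
theorem mtRank_hodgeStructure_eq_two_of_not_isSimple_of_orderOf_eq_eleven [HodgeTensorFacts.{0, 0}] (hns : ¬ ComplexTorus.IsSimple P)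
    {A : Matrix ι ι ℤ} (hA : A ∈ endRingInt P) (hord : orderOf A = 11) (hdim : finrank ℂ E = 5) : (hodgeStructure P 1).mtRank = 2 := by
  have hζ := IsCyclotomicExtension.zeta_spec 11 ℚ (CyclotomicField 11 ℚ)
  obtain ⟨Φ, I, e, he, he₂, -⟩ :=
    exists_cmType_ideal_iso_of_charpoly_eq_cyclotomic hζ hA (charpoly_eq_cyclotomic_eleven_of_orderOf hord hdim P)
  have hX : IsIsomorphic P (periodIso Φ I) := ⟨e, he, he₂⟩
  obtain ⟨φ₀⟩ : Nonempty (CyclotomicField 11 ℚ →+* ℂ) := inferInstance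
  have hnp : ¬ IsPrimitive (ℂ ≃+* ℂ) Φ.1 φ₀ := fun h ↦ hns (hX.isSimple_iff.2 ((isSimple_periodIso_iff_isPrimitive Φ I φ₀).2 h))
  rw [IsIsomorphic.mtRank_hodgeStructure_eq P (periodIso Φ I) (k := 1) hX,
    mtRank_hodgeStructure_periodIso_eq_cmTypeRank_of_two_lt (N := 11) (by norm_num) Φ I, cmTypeRank_eq_two_of_not_isPrimitive_eleven Φ φ₀ hnp]

/-- **`rank MT(X) = 6 ⟺ X` SIMPLE** for a `5`-torus with an endomorphism of order `11`. [cite: Yanai1985, §4 Theorem (p. 171)]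
[cite: MoonenZarhin1999LowDim, §1 (1.2)] -/
theorem mtRank_hodgeStructure_eq_six_iff_isSimple_of_orderOf_eq_eleven [HodgeTensorFacts.{0, 0}] {A : Matrix ι ι ℤ}
    (hA : A ∈ endRingInt P) (hord : orderOf A = 11) (hdim : finrank ℂ E = 5) :
    (hodgeStructure P 1).mtRank = 6 ↔ ComplexTorus.IsSimple P := by
  refine ⟨fun h ↦ ?_, fun hX ↦ hX.mtRank_hodgeStructure_eq_six_of_orderOf_eq_eleven hA hord hdim⟩
  by_contra hns
  rw [mtRank_hodgeStructure_eq_two_of_not_isSimple_of_orderOf_eq_eleven hns hA hord hdim] at h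
  omega

set_option backward.isDefEq.respectTransparency false in -- see above
/-- **`rank MT(X) = 2` FOR EVERY `2`-TORUS WITH AN AUTOMORPHISM OF ORDER `8`** (`P_u = Φ₈`, `X ≅ ℂ²/Φ(𝔞)` for a type of
`ℚ(ζ₈)`, all of rank `2`: `X ∼ E × E`). [cite: Fujiki1988, Thm. 4.1 and Table 6] [cite: MoonenZarhin1999LowDim, §1 (1.2)]
[cite: Shimura1998, §6.1 Thm. 2, §8.4 Example (2)(A) p. 64] -/
theorem mtRank_hodgeStructure_eq_two_of_orderOf_eq_eight [HodgeTensorFacts.{0, 0}] {A : Matrix ι ι ℤ} (hA : A ∈ endRingInt P)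
    (hord : orderOf A = 8) (hdim : finrank ℂ E = 2) : (hodgeStructure P 1).mtRank = 2 := by
  have hζ := IsCyclotomicExtension.zeta_spec 8 ℚ (CyclotomicField 8 ℚ)
  obtain ⟨Φ, I, e, he, he₂, -⟩ := exists_cmType_ideal_iso_of_charpoly_eq_cyclotomic hζ hA
    (charpoly_eq_cyclotomic_of_orderOf_eq_of_finrank P isPrimePow_eight₃₆ hord (by rw [hdim, totients₃₆.2.2.2.1]))
  rw [IsIsomorphic.mtRank_hodgeStructure_eq P (periodIso Φ I) (k := 1) ⟨e, he, he₂⟩,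
    mtRank_hodgeStructure_periodIso_eq_cmTypeRank_of_two_lt (N := 8) (by norm_num) Φ I, cmTypeRank_eq_two_eight Φ]

set_option backward.isDefEq.respectTransparency false in -- see above
/-- **`rank MT(X) = 2` FOR EVERY COMPLEX TORUS WITH AN ENDOMORPHISM OF CHARACTERISTIC POLYNOMIAL `Φ₁₂`** (a `2`-torus `≅ ℂ²/Φ(𝔞)`
for a type of `ℚ(ζ₁₂)`, all of rank `2`). [cite: Fujiki1988, Thm. 4.1 and Table 6] [cite: MoonenZarhin1999LowDim, §1 (1.2)]
[cite: Shimura1998, §6.1 Thm. 2, §8.4 Example (2)(A) p. 64] -/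
theorem mtRank_hodgeStructure_eq_two_of_charpoly_eq_cyclotomic_twelve [HodgeTensorFacts.{0, 0}] {A : Matrix ι ι ℤ}
    (hA : A ∈ endRingInt P) (hP : A.charpoly = cyclotomic 12 ℤ) : (hodgeStructure P 1).mtRank = 2 := by
  have hζ := IsCyclotomicExtension.zeta_spec 12 ℚ (CyclotomicField 12 ℚ)
  obtain ⟨Φ, I, e, he, he₂, -⟩ := exists_cmType_ideal_iso_of_charpoly_eq_cyclotomic hζ hA hP
  rw [IsIsomorphic.mtRank_hodgeStructure_eq P (periodIso Φ I) (k := 1) ⟨e, he, he₂⟩,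
    mtRank_hodgeStructure_periodIso_eq_cmTypeRank_of_two_lt (N := 12) (by norm_num) Φ I, cmTypeRank_eq_two_twelve Φ]

end Tori

end ComplexTorus

end Literature.Geometry.Kaehler

end
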